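import Literature.AlgebraicGeometry.Motives.HodgeStructureDivisorClassesMixedHom
import Literature.AlgebraicGeometry.Motives.HodgeStructurePicardNumberPowers
import HarnessLib

/-!
# The Picard number of a finite direct sum: `dim Hom_HS(⊕ᵢ Hᵢ, H₀) = Σᵢ dim Hom_HS(Hᵢ, H₀)`,
# `ρ(⊕ᵢ Hᵢ) = Σᵢ (ρ(Hᵢ) + Σ_{j < i} dim Hom_HS(Hⱼ, Hᵢ))`, and `ρ(⊕ᵢ Hᵢ) = Σᵢ ρ(Hᵢ)` when the `Hom_HS(Hᵢ, Hⱼ)`, `i ≠ j`, vanish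
# (Hulek–Laface Cor. 2.3, Milne Cor. 4.2)

[topic AlgebraicGeometry/Motives]

Layer `Literature/AlgebraicGeometry/Motives`, lane `lit-hodgefound` (Track 2 foundations library; prover seat `lit-hodgefound-p34`,
generation 27, row g27-#9). THEOREMS ONLY (no `def`, no named fact, no instance, no notation; net debt `0`). Sequel of the seat's g26-#5
`Motives/HodgeStructurePicardNumberDirectSum` (TWO factors, both polarized, odd weight), g26-#8 `Motives/HodgeStructurePicardNumberPowers`
(POWERS `H^{⊕ι}` of one factor; `dim Hom_HS(H₁ ⊕ H₂, H₀) = dim Hom_HS(H₁, H₀) + dim Hom_HS(H₂, H₀)`) and g27-#1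
`Motives/HodgeStructureDivisorClassesMixedHom` (`ρ(H₁ ⊕ H₂) = ρ(H₁) + ρ(H₂) + dim Hom_HS(H₁, H₂)`, every weight, `H₁` polarized). Here
FINITELY MANY DISTINCT FACTORS `Hᵢ` (on carriers `Xᵢ`, `i ∈ ι` finite), by induction over finite sub-families.

## The sources, verbatim

K. Hulek, R. Laface, *On the Picard numbers of abelian varieties* (2019) [HulekLaface2019PicardNumbersAV] (held text
`paper:arxiv-1703.05882` p0005), §2.1 Prop. 2.2: "Let `A₁, …, A_r` be simple abelian varieties, such that `Aᵢ` is not isogenous to `Aⱼ`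
for `i ≠ j`. Then the (exterior) pullback of line bundles yields an isomorphism `∏ Pic(Aᵢ^{nᵢ}) ≅ Pic(∏ Aᵢ^{nᵢ})`" (proof: "By assumption
[…] `Hom(Aᵢ, Aⱼ) = Hom(Aᵢ, Aⱼ^∨) = 0`"); Cor. 2.3: "Then, `ρ(∏_{i=1}^r Aᵢ^{nᵢ}) = Σ_{i=1}^r ρ(Aᵢ^{nᵢ})`." J. S. Milne, *Lefschetz classes
on abelian varieties* (1999) [Milne1999LefschetzClasses], §4 Cor. 4.2 (p. 658): "An isogeny `A → A₁^{r₁} × ⋯ × A_s^{r_s}` with the `Aᵢ`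
simple and pairwise nonisogenous abelian varieties defines an isomorphism of `D(A)_k` onto the subring `D(A₁^{r₁})_k ⊗ ⋯ ⊗ D(A_s^{r_s})_k`
[…] *Proof.* […] if `A` and `B` are abelian varieties with `Hom(A, B) = 0`, then `DC(A, B) = 0` […] The general statement follows from
this by induction."

## Reading on the carrier, and what is PROVED

`ι` a finite index type, `Hᵢ` pure `ℚ`-Hodge structures of one weight `n` on finite-dimensional `Xᵢ` (one universe), `⊕_{i ∈ s} Hᵢ =
HodgeStructure.pi (i : ↥s ↦ Hᵢ)` for a finite set `s ⊆ ι`; `ρ(H) = dim B¹(H) = dim Hdg_n(⋀²H)`; `Hom_HS = HodgeStructure.Hom`.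

* §1 Two isomorphisms of Hodge structures (bijective morphisms built from the tree's `Hom.piLift`, `Hom.piProj`, `Hom.prodLift`):
  `⊕_{i ∈ univ} Hᵢ ⥲ ⊕ᵢ Hᵢ` (`piLift_piProj_univ_bijective`) and `⊕_{i ∈ s ∪ {a}} Hᵢ ⥲ (⊕_{i ∈ s} Hᵢ) ⊕ H_a` for `a ∉ s`
  (`prodLift_piLift_piProj_insert_bijective`).
* §2 **`dim Hom_HS(⊕_{i ∈ s} Hᵢ, H₀) = Σ_{i ∈ s} dim Hom_HS(Hᵢ, H₀)`** and **`dim Hom_HS(⊕ᵢ Hᵢ, H₀) = Σᵢ dim Hom_HS(Hᵢ, H₀)`** (Hodge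
  structures form an additive category: g26-#8's two-factor step, iterated) (`finrank_hom_pi_finset_eq_sum`, `finrank_hom_pi_eq_sum`).
* §3 All `Hᵢ` polarized: THE RECURSION **`ρ(⊕_{i ∈ s ∪ {a}} Hᵢ) = ρ(⊕_{i ∈ s} Hᵢ) + ρ(H_a) + Σ_{i ∈ s} dim Hom_HS(Hᵢ, H_a)`** (`a ∉ s`;
  g27-#1's two-factor formula with the direct-sum polarization `Polarization.pi`) (`Polarization.finrank_hodgeClasses_two_pi_insert`), and
  HULEK–LAFACE COR. 2.3 / MILNE COR. 4.2 (`ρ`-part) ON THE CARRIER: **if `Hom_HS(Hᵢ, Hⱼ) = 0` for all `i ≠ j` then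
  `ρ(⊕_{i ∈ s} Hᵢ) = Σ_{i ∈ s} ρ(Hᵢ)` and `ρ(⊕ᵢ Hᵢ) = Σᵢ ρ(Hᵢ)`** (`Polarization.finrank_hodgeClasses_two_pi_finset_eq_sum_of_subsingleton_hom`,
  `Polarization.finrank_hodgeClasses_two_pi_eq_sum_of_subsingleton_hom`).
* §4 Along a linear order on the index type, THE GENERAL FORMULA **`ρ(⊕_{i ∈ s} Hᵢ) = Σ_{i ∈ s} (ρ(Hᵢ) + Σ_{j ∈ s, j < i} dim Hom_HS(Hⱼ, Hᵢ))`**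
  and **`ρ(⊕ᵢ Hᵢ) = Σᵢ (ρ(Hᵢ) + Σ_{j < i} dim Hom_HS(Hⱼ, Hᵢ))`** (`Polarization.finrank_hodgeClasses_two_pi_finset_eq`,
  `Polarization.finrank_hodgeClasses_two_pi_eq`; the recursion unrolled with `Finset.induction_on_max`).

NOT here: the powers `Aᵢ^{nᵢ}` inside the factors (g26-#8 computes `ρ(H^{⊕r})`); the `D•`-ring statement of Milne's Cor. 4.2 for more
than two factors (g27-#2/#4 do two).

## References

* [HulekLaface2019PicardNumbersAV] K. Hulek, R. Laface, *On the Picard numbers of abelian varieties*, Ann. Sc. Norm. Super. Pisa (2019),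
  §2.1 Prop. 2.2, Cor. 2.3.
* [Milne1999LefschetzClasses] J. S. Milne, *Lefschetz classes on abelian varieties*, Duke Math. J. 96 (1999), §4 Cor. 4.2 (p. 658).
* [DeligneHodgeII1971] P. Deligne, *Théorie de Hodge II* (1971), 2.1 (direct sums of Hodge structures), 2.1.15 (polarizations).
-/

noncomputable section

namespace Literature.AlgebraicGeometry.Motives.HodgeStructure

universe u

variable {ι : Type} [Fintype ι] [DecidableEq ι] {X : ι → Type u} [∀ i, AddCommGroup (X i)] [∀ i, Module ℚ (X i)] {n : ℤ}
  (H : ∀ i, HodgeStructure (X i) n)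

/-! ## §1 `⊕_{i ∈ univ} Hᵢ ≅ ⊕ᵢ Hᵢ` and `⊕_{i ∈ s ∪ {a}} Hᵢ ≅ (⊕_{i ∈ s} Hᵢ) ⊕ H_a` -/

/-- **`⊕_{i ∈ univ} Hᵢ → ⊕ᵢ Hᵢ`, `x ↦ (x ⟨i, _⟩)ᵢ`, is a bijective morphism** (the morphism `Hom.piLift (i ↦ pr_{⟨i, _⟩})`; inverse
`y ↦ (y j.1)_j`). [cite: DeligneHodgeII1971, 2.1] -/
theorem piLift_piProj_univ_bijective :
    Function.Bijective
      (Hom.piLift fun i : ι ↦ Hom.piProj (fun j : ↥(Finset.univ : Finset ι) ↦ H j.1) ⟨i, Finset.mem_univ i⟩ :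
        Hom (HodgeStructure.pi fun j : ↥(Finset.univ : Finset ι) ↦ H j.1) (HodgeStructure.pi H)).toLinearMap := by
  set f := (Hom.piLift fun i : ι ↦ Hom.piProj (fun j : ↥(Finset.univ : Finset ι) ↦ H j.1) ⟨i, Finset.mem_univ i⟩ :
    Hom (HodgeStructure.pi fun j : ↥(Finset.univ : Finset ι) ↦ H j.1) (HodgeStructure.pi H)).toLinearMap with hf
  have happly : ∀ x, f x = fun i ↦ x ⟨i, Finset.mem_univ i⟩ := fun x ↦ rfl
  refine Function.bijective_iff_has_inverse.2 ⟨fun y j ↦ y j.1, fun x ↦ ?_, fun y ↦ ?_⟩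
  · rw [happly]
  · rw [happly]

/-- **`⊕_{i ∈ s ∪ {a}} Hᵢ → (⊕_{i ∈ s} Hᵢ) ⊕ H_a`, `x ↦ ((x ⟨i, _⟩)_{i ∈ s}, x ⟨a, _⟩)`, is a bijective morphism for `a ∉ s`**
(the morphism `Hom.prodLift (Hom.piLift (i ↦ pr_{⟨i, _⟩})) pr_{⟨a, _⟩}`; injective since every index of `s ∪ {a}` is `a` or in `s`,
and the two sides have the same dimension). [cite: DeligneHodgeII1971, 2.1] -/
theorem prodLift_piLift_piProj_insert_bijective [∀ i, Module.Finite ℚ (X i)] {s : Finset ι} {a : ι} (ha : a ∉ s) :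
    Function.Bijective
      (Hom.prodLift
          (Hom.piLift fun i : ↥s ↦ Hom.piProj (fun j : ↥(insert a s) ↦ H j.1) ⟨i.1, Finset.mem_insert_of_mem i.2⟩)
          (Hom.piProj (fun j : ↥(insert a s) ↦ H j.1) ⟨a, Finset.mem_insert_self a s⟩) :
        Hom (HodgeStructure.pi fun j : ↥(insert a s) ↦ H j.1) ((HodgeStructure.pi fun i : ↥s ↦ H i.1).prod (H a))).toLinearMap := by
  set f := (Hom.prodLift
      (Hom.piLift fun i : ↥s ↦ Hom.piProj (fun j : ↥(insert a s) ↦ H j.1) ⟨i.1, Finset.mem_insert_of_mem i.2⟩)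
      (Hom.piProj (fun j : ↥(insert a s) ↦ H j.1) ⟨a, Finset.mem_insert_self a s⟩) :
    Hom (HodgeStructure.pi fun j : ↥(insert a s) ↦ H j.1) ((HodgeStructure.pi fun i : ↥s ↦ H i.1).prod (H a))).toLinearMap with hf
  have happly : ∀ x, f x = (fun i : ↥s ↦ x ⟨i.1, Finset.mem_insert_of_mem i.2⟩, x ⟨a, Finset.mem_insert_self a s⟩) := fun x ↦ rfl
  have hinj : Function.Injective f := by
    intro x x' h
    rw [happly, happly, Prod.mk.injEq] at h
    funext j
    rcases Finset.mem_insert.1 j.2 with hj | hj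
    · have e : j = ⟨a, Finset.mem_insert_self a s⟩ := Subtype.ext hj
      subst e
      exact h.2
    · exact congrFun h.1 ⟨j.1, hj⟩
  have h1 : ∑ i : ↥(insert a s), Module.finrank ℚ (X i.1) = ∑ i ∈ insert a s, Module.finrank ℚ (X i) :=
    Finset.sum_coe_sort (insert a s) (fun i ↦ Module.finrank ℚ (X i))
  have h2 : ∑ i : ↥s, Module.finrank ℚ (X i.1) = ∑ i ∈ s, Module.finrank ℚ (X i) :=
    Finset.sum_coe_sort s (fun i ↦ Module.finrank ℚ (X i))
  have hdim : Module.finrank ℚ (∀ j : ↥(insert a s), X j.1) = Module.finrank ℚ ((∀ i : ↥s, X i.1) × X a) := by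
    rw [Module.finrank_prod, Module.finrank_pi_fintype, Module.finrank_pi_fintype, h1, h2, Finset.sum_insert ha, add_comm]
  exact ⟨hinj, (LinearMap.injective_iff_surjective_of_finrank_eq_finrank hdim).1 hinj⟩

/-! ## §2 `dim Hom_HS(⊕ Hᵢ, H₀) = Σ dim Hom_HS(Hᵢ, H₀)` -/

section Hom

variable {V₀ : Type u} [AddCommGroup V₀] [Module ℚ V₀] [Module.Finite ℚ V₀] (H₀ : HodgeStructure V₀ n) [∀ i, Module.Finite ℚ (X i)]

/-- **`dim Hom_HS(⊕_{i ∈ s} Hᵢ, H₀) = Σ_{i ∈ s} dim Hom_HS(Hᵢ, H₀)`** for a finite sub-family (induction on `s`: the empty sum has no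
non-zero morphism out of it; `⊕_{s ∪ {a}} ≅ ⊕_s ⊕ H_a` and g26-#8's `dim Hom_HS(H₁ ⊕ H₂, H₀) = dim Hom_HS(H₁, H₀) + dim Hom_HS(H₂, H₀)`).
[cite: DeligneHodgeII1971, 2.1] [cite: HulekLaface2019PicardNumbersAV, §2.1 Prop. 2.2 (proof)] -/
theorem finrank_hom_pi_finset_eq_sum (s : Finset ι) :
    Module.finrank ℚ (Hom (HodgeStructure.pi fun j : ↥s ↦ H j.1) H₀) = ∑ i ∈ s, Module.finrank ℚ (Hom (H i) H₀) := by
  induction s using Finset.induction_on with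
  | empty =>
    haveI : Subsingleton (Hom (HodgeStructure.pi fun j : ↥(∅ : Finset ι) ↦ H j.1) H₀) :=
      Hom.toLinearMap_injective.subsingleton
    rw [Finset.sum_empty, Module.finrank_zero_of_subsingleton]
  | insert a s ha ih =>
    rw [Finset.sum_insert ha, ← ih, ← Hom.finrank_hom_eq_of_bijective _ (prodLift_piLift_piProj_insert_bijective H ha) H₀,
      finrank_hom_prod_eq, add_comm]

/-- **`dim Hom_HS(⊕ᵢ Hᵢ, H₀) = Σᵢ dim Hom_HS(Hᵢ, H₀)`** — a morphism out of a finite direct sum is the family of its restrictions.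
[cite: DeligneHodgeII1971, 2.1] [cite: HulekLaface2019PicardNumbersAV, §2.1 Prop. 2.2 (proof)] -/
theorem finrank_hom_pi_eq_sum :
    Module.finrank ℚ (Hom (HodgeStructure.pi H) H₀) = ∑ i, Module.finrank ℚ (Hom (H i) H₀) := by
  rw [Hom.finrank_hom_eq_of_bijective _ (piLift_piProj_univ_bijective H) H₀, finrank_hom_pi_finset_eq_sum]

end Hom

/-! ## §3 The Picard number of a finite direct sum -/

section Picard

variable [HodgeTensorFacts.{u, u}] [∀ i, Module.Finite ℚ (X i)] (Q : ∀ i, Polarization (H i))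

include Q in
/-- **THE RECURSION `ρ(⊕_{i ∈ s ∪ {a}} Hᵢ) = ρ(⊕_{i ∈ s} Hᵢ) + ρ(H_a) + Σ_{i ∈ s} dim Hom_HS(Hᵢ, H_a)`** (`a ∉ s`, all `Hᵢ` polarized, every
weight): g27-#1's `ρ(H₁ ⊕ H₂) = ρ(H₁) + ρ(H₂) + dim Hom_HS(H₁, H₂)` for `H₁ = ⊕_{i ∈ s} Hᵢ` (polarized by `⊕ Qᵢ`) and `H₂ = H_a`, and
`Hom_HS(⊕_{i ∈ s} Hᵢ, H_a) = ⊕_{i ∈ s} Hom_HS(Hᵢ, H_a)`. [cite: HulekLaface2019PicardNumbersAV, §2.1 Prop. 2.2 and Cor. 2.3]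
[cite: Milne1999LefschetzClasses, §4 Cor. 4.2 (proof, "by induction") (p. 658)] -/
theorem Polarization.finrank_hodgeClasses_two_pi_insert {s : Finset ι} {a : ι} (ha : a ∉ s) :
    Module.finrank ℚ ↥(((HodgeStructure.pi fun j : ↥(insert a s) ↦ H j.1).exteriorPower 2).hodgeClasses n) =
      Module.finrank ℚ ↥(((HodgeStructure.pi fun j : ↥s ↦ H j.1).exteriorPower 2).hodgeClasses n) +
        Module.finrank ℚ ↥(((H a).exteriorPower 2).hodgeClasses n) + ∑ i ∈ s, Module.finrank ℚ (Hom (H i) (H a)) := by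
  rw [(Hom.prodLift
      (Hom.piLift fun i : ↥s ↦ Hom.piProj (fun j : ↥(insert a s) ↦ H j.1) ⟨i.1, Finset.mem_insert_of_mem i.2⟩)
      (Hom.piProj (fun j : ↥(insert a s) ↦ H j.1) ⟨a, Finset.mem_insert_self a s⟩)).finrank_hodgeClasses_exteriorPower_eq_of_bijective
      (prodLift_piLift_piProj_insert_bijective H ha) 2 n,
    (Polarization.pi fun i : ↥s ↦ Q i.1).finrank_hodgeClasses_two_prod_eq_add_finrank_hom (H a),
    finrank_hom_pi_finset_eq_sum H (H a) s]

include Q in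
/-- **HULEK–LAFACE COR. 2.3 / MILNE COR. 4.2 (`ρ`-part) ON THE CARRIER, finite sub-families: if `Hom_HS(Hᵢ, Hⱼ) = 0` for all `i ≠ j`
(pairwise "non-isogenous" polarized factors), then `ρ(⊕_{i ∈ s} Hᵢ) = Σ_{i ∈ s} ρ(Hᵢ)`.** [cite: HulekLaface2019PicardNumbersAV, §2.1 Cor. 2.3]
[cite: Milne1999LefschetzClasses, §4 Cor. 4.2 (p. 658)] -/
theorem Polarization.finrank_hodgeClasses_two_pi_finset_eq_sum_of_subsingleton_hom
    (hHom : ∀ i j, i ≠ j → Subsingleton (Hom (H i) (H j))) (s : Finset ι) :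
    Module.finrank ℚ ↥(((HodgeStructure.pi fun j : ↥s ↦ H j.1).exteriorPower 2).hodgeClasses n) =
      ∑ i ∈ s, Module.finrank ℚ ↥(((H i).exteriorPower 2).hodgeClasses n) := by
  induction s using Finset.induction_on with
  | empty =>
    have h0 : Module.finrank ℚ (⋀[ℚ]^2 (∀ j : ↥(∅ : Finset ι), X j.1)) = 0 := by
      rw [exteriorPower.finrank_eq, Module.finrank_pi_fintype, Finset.univ_eq_empty, Finset.sum_empty,
        Nat.choose_eq_zero_of_lt (by norm_num)]
    have h1 := Submodule.finrank_le (((HodgeStructure.pi fun j : ↥(∅ : Finset ι) ↦ H j.1).exteriorPower 2).hodgeClasses n)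
    rw [Finset.sum_empty]
    omega
  | insert a s ha ih =>
    have hz : ∑ i ∈ s, Module.finrank ℚ (Hom (H i) (H a)) = 0 := Finset.sum_eq_zero fun i hi ↦ by
      haveI := hHom i a (ne_of_mem_of_not_mem hi ha)
      exact Module.finrank_zero_of_subsingleton
    rw [Polarization.finrank_hodgeClasses_two_pi_insert H Q ha, ih, Finset.sum_insert ha, hz]
    omega

include Q in
/-- **HULEK–LAFACE COR. 2.3 / MILNE COR. 4.2 (`ρ`-part) ON THE CARRIER: if `Hom_HS(Hᵢ, Hⱼ) = 0` for all `i ≠ j`, then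
`ρ(⊕ᵢ Hᵢ) = Σᵢ ρ(Hᵢ)`** — "`ρ(∏ Aᵢ^{nᵢ}) = Σ ρ(Aᵢ^{nᵢ})`" for pairwise non-isogenous simple factors (`Hom(Aᵢ, Aⱼ) = 0`).
[cite: HulekLaface2019PicardNumbersAV, §2.1 Cor. 2.3] [cite: Milne1999LefschetzClasses, §4 Cor. 4.2 (p. 658)] -/
theorem Polarization.finrank_hodgeClasses_two_pi_eq_sum_of_subsingleton_hom
    (hHom : ∀ i j, i ≠ j → Subsingleton (Hom (H i) (H j))) :
    Module.finrank ℚ ↥(((HodgeStructure.pi H).exteriorPower 2).hodgeClasses n) =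
      ∑ i, Module.finrank ℚ ↥(((H i).exteriorPower 2).hodgeClasses n) := by
  rw [← (Hom.piLift fun i : ι ↦ Hom.piProj (fun j : ↥(Finset.univ : Finset ι) ↦ H j.1) ⟨i, Finset.mem_univ i⟩ :
      Hom (HodgeStructure.pi fun j : ↥(Finset.univ : Finset ι) ↦ H j.1)
        (HodgeStructure.pi H)).finrank_hodgeClasses_exteriorPower_eq_of_bijective (piLift_piProj_univ_bijective H) 2 n,
    Polarization.finrank_hodgeClasses_two_pi_finset_eq_sum_of_subsingleton_hom H Q hHom]

/-! ## §4 Along a linear order: `ρ(⊕_{i ∈ s} Hᵢ) = Σ_{i ∈ s} (ρ(Hᵢ) + Σ_{j ∈ s, j < i} dim Hom_HS(Hⱼ, Hᵢ))` -/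

include Q in
/-- **THE PICARD NUMBER OF A FINITE DIRECT SUM: `ρ(⊕_{i ∈ s} Hᵢ) = Σ_{i ∈ s} ρ(Hᵢ) + Σ_{j < i in s} dim Hom_HS(Hⱼ, Hᵢ)`** (index type
linearly ordered to name each unordered pair once; all `Hᵢ` polarized, every weight) — the recursion of §3 unrolled by inserting the
factors in increasing order (`Finset.induction_on_max`). For pairwise `Hom_HS = 0` this is Cor. 2.3; for two factors it is g27-#1's
`ρ(H₁ ⊕ H₂) = ρ(H₁) + ρ(H₂) + dim Hom_HS(H₁, H₂)`. [cite: HulekLaface2019PicardNumbersAV, §2.1 Prop. 2.2 (proof) and Cor. 2.3]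
[cite: Milne1999LefschetzClasses, §4 Cor. 4.2 (proof, "by induction") (p. 658)] -/
theorem Polarization.finrank_hodgeClasses_two_pi_finset_eq [LinearOrder ι] (s : Finset ι) :
    Module.finrank ℚ ↥(((HodgeStructure.pi fun j : ↥s ↦ H j.1).exteriorPower 2).hodgeClasses n) =
      ∑ i ∈ s, (Module.finrank ℚ ↥(((H i).exteriorPower 2).hodgeClasses n) +
        ∑ j ∈ s.filter (· < i), Module.finrank ℚ (Hom (H j) (H i))) := by
  induction s using Finset.induction_on_max with
  | empty =>
    have h0 : Module.finrank ℚ (⋀[ℚ]^2 (∀ j : ↥(∅ : Finset ι), X j.1)) = 0 := by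
      rw [exteriorPower.finrank_eq, Module.finrank_pi_fintype, Finset.univ_eq_empty, Finset.sum_empty,
        Nat.choose_eq_zero_of_lt (by norm_num)]
    have h1 := Submodule.finrank_le (((HodgeStructure.pi fun j : ↥(∅ : Finset ι) ↦ H j.1).exteriorPower 2).hodgeClasses n)
    rw [Finset.sum_empty]
    omega
  | insert a s hlt ih =>
    have ha : a ∉ s := fun h ↦ lt_irrefl a (hlt a h)
    have h1 : (insert a s).filter (· < a) = s := by
      ext j
      simp only [Finset.mem_filter, Finset.mem_insert]
      constructor
      · rintro ⟨hj | hj, hlt'⟩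
        · exact absurd hlt' (hj ▸ lt_irrefl a)
        · exact hj
      · exact fun hj ↦ ⟨Or.inr hj, hlt j hj⟩
    have h2 : ∀ i ∈ s, (insert a s).filter (· < i) = s.filter (· < i) := fun i hi ↦ by
      ext j
      simp only [Finset.mem_filter, Finset.mem_insert]
      constructor
      · rintro ⟨hj | hj, hlt'⟩
        · exact absurd (hj ▸ hlt') (not_lt.2 (hlt i hi).le)
        · exact ⟨hj, hlt'⟩
      · exact fun ⟨hj, hlt'⟩ ↦ ⟨Or.inr hj, hlt'⟩
    have h3 : ∑ i ∈ s, (Module.finrank ℚ ↥(((H i).exteriorPower 2).hodgeClasses n) +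
          ∑ j ∈ (insert a s).filter (· < i), Module.finrank ℚ (Hom (H j) (H i))) =
        ∑ i ∈ s, (Module.finrank ℚ ↥(((H i).exteriorPower 2).hodgeClasses n) +
          ∑ j ∈ s.filter (· < i), Module.finrank ℚ (Hom (H j) (H i))) :=
      Finset.sum_congr rfl fun i hi ↦ by rw [h2 i hi]
    rw [Polarization.finrank_hodgeClasses_two_pi_insert H Q ha, ih, Finset.sum_insert ha, h1, h3]
    omega

include Q in
/-- **`ρ(⊕ᵢ Hᵢ) = Σᵢ (ρ(Hᵢ) + Σ_{j < i} dim Hom_HS(Hⱼ, Hᵢ))`** over a linearly ordered finite index type (all `Hᵢ` polarized, every weight).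
[cite: HulekLaface2019PicardNumbersAV, §2.1 Prop. 2.2 (proof) and Cor. 2.3] [cite: Milne1999LefschetzClasses, §4 Cor. 4.2 (p. 658)] -/
theorem Polarization.finrank_hodgeClasses_two_pi_eq [LinearOrder ι] :
    Module.finrank ℚ ↥(((HodgeStructure.pi H).exteriorPower 2).hodgeClasses n) =
      ∑ i, (Module.finrank ℚ ↥(((H i).exteriorPower 2).hodgeClasses n) +
        ∑ j ∈ Finset.univ.filter (· < i), Module.finrank ℚ (Hom (H j) (H i))) := by
  rw [← (Hom.piLift fun i : ι ↦ Hom.piProj (fun j : ↥(Finset.univ : Finset ι) ↦ H j.1) ⟨i, Finset.mem_univ i⟩ :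
      Hom (HodgeStructure.pi fun j : ↥(Finset.univ : Finset ι) ↦ H j.1)
        (HodgeStructure.pi H)).finrank_hodgeClasses_exteriorPower_eq_of_bijective (piLift_piProj_univ_bijective H) 2 n,
    Polarization.finrank_hodgeClasses_two_pi_finset_eq H Q Finset.univ]

end Picard

end Literature.AlgebraicGeometry.Motives.HodgeStructure

end
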